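import Mathlib
import Summits.NavierStokesRegularity.NavierStokesRegularity.Theorems.TaoLadderRungTwoBreakOneShiftWindowRTermDSound
import Summits.NavierStokesRegularity.NavierStokesRegularity.Theorems.TaoLadderRungTwoBreakOneShiftWindowCentreStepD
import Summits.NavierStokesRegularity.NavierStokesRegularity.Theorems.TaoLadderRungTwoBreakOneShiftWindowStepBootstrap
import HarnessLib

/-!
# The one-shift window system, XXXI: THE ROUGH STEP FROM DYADIC DATA — one Boolean `RoughStepD.check` over the
# term data of a step (part XXX), the boxes `W ⊆ S`, the step `h`, the centre `C¹` box `VV`, the deviation vector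
# `Ẑ`, a margin `η` and a contraction direction `ζ`, which, when `true`, yields: the centre family of the step
# (part XXVIII) AND, for EVERY rough realisation (tails in the tubes) and every run of it from the start box, the
# a-priori hull `Hs = S ± (Ẑ + η)` and the deviation bound `|S_u(t) − uc(a)(t)| ≤ Ẑ` (parts XVII/XXIX)
# (cell harvest/h2-tao-ladder, seat p2; rung1/KERNEL-CHEAP-REPLAY-SPEC.md §2 (c)/(d)/(f), §7 «CHECKER» (c)/(d), (O1);
# support for K1(1) = `NoSurvivingDSSOne`, stmt-NavierStokesRegularity-20205)

MODEL lattice ODEs only (Tao 2016 §4 normal form on Tao's shift set `S`); nothing here is a statement about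
the Navier–Stokes equations; no item is closed; no instance is evaluated here. Generic in `ι` (numbered by
`e : ι ≃ Fin n`) and `κ`; COMPUTATIONAL (referee P162) once an instance's `check` is evaluated by `native_decide`.

THE COMPUTATION: the centre-step test of part XXVIII on `sqC n prec RD`; the hull `Hs_c = [S_c.lo − (Ẑ_c + η),
S_c.hi + (Ẑ_c + η)]`; the centre Jacobian rows over `Hs` (`jacRow`, part XXX) ⇒ `dg_c = hi (J_cc)`, `R_cj = mag (J_cj)`
(`j ≠ c`); the field-deviation bounds `cb_c = mag (cbRow)` over `Hs`; the weights `E_c = h·(1 + max(dg_c h, 0))`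
(a bound of `∫₀ʰ e^{dg r} dr` valid for `dg_c h ≤ 1`, `gronwallBound_le_lin`); and the Kapela–Zgliczyński checks
`((R Ẑ)_c + cb_c)·E_c ≤ Ẑ_c`, `(R ζ)_c·E_c ≤ ζ_c`, with `Ẑ ≥ 0`, `ζ > 0`, `η > 0` (all in rounded interval arithmetic,
upper endpoints compared).

THE THEOREM (`RoughStepD.sound`): if the data presents the centre term list `Tc` and a time-dependent family of
rough term lists `Tf t` (`IsRTEncl`, part XXX) and `check = true`, then there is a centre family `uc` with the
conclusions of part XXVIII, `boxSet S ⊆ boxSet Hs`, and for every `a ∈ boxSet W` and every `Su` with `Su 0 = a`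
solving `x' = termField (Tf t) x` within `[0, h]`: `Su t ∈ boxSet Hs` and `|Su t i − uc a t i| ≤ Ẑ_{e i}` for all
`t ∈ [0, h]` — the hull memberships `hmem` and the proximity data of parts XVI/XVII for the rough runs.
-/

-- the sub-problem namespace repeats the summit name by design (D-0017)
set_option linter.dupNamespace false

namespace Summit.NavierStokesRegularity.NavierStokesRegularity.Theorems

namespace DSSOneShift

open Set Finset Metric Filter Topology TopologicalSpace
open Literature.Analysis.ODE
open Summit.NavierStokesRegularity.NavierStokesRegularity.Theorems.TaylorModelCert
open Summit.NavierStokesRegularity.NavierStokesRegularity.Theorems.TaylorModelReadout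
open Summit.NavierStokesRegularity.NavierStokesRegularity.Theorems.CertificateGlueOn

/-! ### A computable bound of the Grönwall weight -/

/-- For `h ≥ 0` and `K h ≤ 1`: `gronwallBound 0 K 1 h = ∫₀ʰ e^{K r} dr ≤ h · (1 + max (K h) 0)`
(from `e^x ≤ 1 + x + x²` on `|x| ≤ 1`, resp. `e^x ≥ 1 + x`). [folklore] -/
theorem gronwallBound_le_lin {K h : ℝ} (hh : 0 ≤ h) (hKh : K * h ≤ 1) :
    gronwallBound 0 K 1 h ≤ h * (1 + max (K * h) 0) := by
  by_cases hK : K = 0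
  · simp [hK, gronwallBound_K0]
  · simp only [gronwallBound_of_K_ne_0 hK, zero_mul, zero_add]
    rcases lt_or_gt_of_ne hK with hneg | hpos
    · have h1 : K * h + 1 ≤ Real.exp (K * h) := Real.add_one_le_exp _
      have hmax : max (K * h) 0 = 0 := max_eq_right (mul_nonpos_of_nonpos_of_nonneg hneg.le hh)
      rw [hmax, add_zero, mul_one]
      have hk : 1 / K < 0 := by rw [one_div]; exact inv_lt_zero.2 hneg
      calc 1 / K * (Real.exp (K * h) - 1) ≤ 1 / K * (K * h) := mul_le_mul_of_nonpos_left (by linarith) hk.le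
        _ = h := by rw [one_div, inv_mul_cancel_left₀ hK]
    · have hx0 : 0 ≤ K * h := mul_nonneg hpos.le hh
      have habs : |K * h| ≤ 1 := by rw [abs_of_nonneg hx0]; exact hKh
      have h2 := Real.abs_exp_sub_one_sub_id_le habs
      have h3 : Real.exp (K * h) - 1 ≤ K * h + (K * h) ^ 2 := by
        have := (abs_le.1 h2).2; linarith
      have hmax : max (K * h) 0 = K * h := max_eq_left hx0
      rw [hmax]
      have hk : 0 ≤ 1 / K := by rw [one_div]; exact (inv_pos.2 hpos).le
      calc 1 / K * (Real.exp (K * h) - 1) ≤ 1 / K * (K * h + (K * h) ^ 2) := mul_le_mul_of_nonneg_left h3 hk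
        _ = h * (1 + K * h) := by field_simp

/-- Magnitudes are non-negative. [folklore] -/
theorem mag_toReal_nonneg (I : IntervalD) : 0 ≤ (IntervalD.mag I).toReal := by
  simp only [IntervalD.mag, Dyad.toReal_max, Dyad.toReal_abs]
  exact le_max_of_le_left (abs_nonneg _)

/-! ### The dyadic data of a rough step and its Boolean test -/

/-- **The dyadic data of one rough step**: precision, order, dimension, the term data `RD` (part XXX), the start
box `W`, the centre a-priori box `S`, the step `hD`, the centre `C¹` box `VV`, the deviation vector `Zh` (= SPEC `Δ_s`),
the hull margin `eta` and the contraction direction `zeta`. [cite: KapelaZgliczynski2009, §4 Lemma 4.1; cell vocabulary, harvest/h2-tao-ladder rung1/KERNEL-CHEAP-REPLAY-SPEC.md §2 (d)] -/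
structure RoughStepD where
  /-- mantissa bits -/
  prec : ℕ
  /-- Taylor order -/
  K : ℕ
  /-- number of physical coordinates -/
  n : ℕ
  /-- term data -/
  RD : RRows
  /-- start box -/
  W : Array IntervalD
  /-- centre a-priori box -/
  S : Array IntervalD
  /-- step length -/
  hD : Dyad
  /-- centre C¹ box, column-major -/
  VV : Array IntervalD
  /-- deviation vector Ẑ -/
  Zh : Array Dyad
  /-- hull margin -/
  eta : Dyad
  /-- contraction direction -/
  zeta : Array Dyad

namespace RoughStepD

variable (d : RoughStepD)

/-- Reader of a dyadic vector (junk `0`). [folklore] -/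
def dget (A : Array Dyad) (c : ℕ) : Dyad := if h : c < A.size then A[c] else Dyad.ofInt 0

/-- The centre-step data (part XXVIII) on the derived centre rows. [folklore] -/
def centre : CentreStepD :=
  { prec := d.prec, K := d.K, n := d.n, SD := sqC d.n d.prec d.RD, W := d.W, S := d.S, hD := d.hD, VV := d.VV }

/-- The hull `Hs_c = [S_c.lo − (Ẑ_c + η), S_c.hi + (Ẑ_c + η)]` (the engine's `U′ = U + 2Δ`). [cite: KapelaZgliczynski2009, §4 Lemma 4.1; cell vocabulary, harvest/h2-tao-ladder rung1/KERNEL-CHEAP-REPLAY-SPEC.md §2 (d) (U′ = U + 2Δ)] -/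
def Hs : Array IntervalD :=
  Array.ofFn fun c : Fin d.n =>
    ⟨(IntervalD.aget d.S c).lo.sub ((dget d.Zh c).add d.eta), (IntervalD.aget d.S c).hi.add ((dget d.Zh c).add d.eta)⟩

/-- The centre Jacobian entry box `(c, j)` over the hull. [folklore] -/
def jac (c j : ℕ) : IntervalD := jacRow d.prec d.Hs j (rrow d.RD c)

/-- `dg_c = hi (J_cc)`. [folklore] -/
def dgD (c : ℕ) : Dyad := (d.jac c c).hi

/-- `R_cj = mag (J_cj)` off the diagonal, `0` on it. [folklore] -/
def RD' (c j : ℕ) : Dyad := if c = j then Dyad.ofInt 0 else IntervalD.mag (d.jac c j)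

/-- `cb_c = mag (cbRow)` over the hull. [folklore] -/
def cbD (c : ℕ) : Dyad := IntervalD.mag (cbRow d.prec d.Hs (rrow d.RD c))

/-- `max (dg_c h) 0`. [folklore] -/
def xplus (c : ℕ) : Dyad := Dyad.max ((d.dgD c).mul d.hD) (Dyad.ofInt 0)

/-- `E_c = h · (1 + max (dg_c h) 0)`. [folklore] -/
def ED (c : ℕ) : Dyad := d.hD.mul ((Dyad.ofInt 1).add (d.xplus c))

/-- Upper endpoint of `((Σ_j R_cj v_j) + w) · E_c` in rounded interval arithmetic. [folklore] -/
def kzLhs (c : ℕ) (v : ℕ → Dyad) (w : Dyad) : IntervalD :=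
  IntervalD.mulR d.prec
    (IntervalD.addR d.prec
      (IntervalD.rangeSumR d.prec (fun j => IntervalD.mulR d.prec (IntervalD.ofDyad (d.RD' c j)) (IntervalD.ofDyad (v j))) d.n)
      (IntervalD.ofDyad w))
    (IntervalD.ofDyad (d.ED c))

/-- The rough-step test proper (given that the centre test passed). [cite: KapelaZgliczynski2009, §4 Lemma 4.1 (the matrix/vector inequalities)] -/
def checkKZ : Bool :=
  Dyad.blt (Dyad.ofInt 0) d.eta &&
  (List.range d.n).all fun c =>
    Dyad.ble (Dyad.ofInt 0) (dget d.Zh c) && Dyad.blt (Dyad.ofInt 0) (dget d.zeta c) &&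
    Dyad.ble (d.xplus c) (Dyad.ofInt 1) &&
    IntervalD.hiLe (d.kzLhs c (dget d.Zh) (d.cbD c)) (dget d.Zh c) &&
    IntervalD.hiLe (d.kzLhs c (dget d.zeta) (Dyad.ofInt 0)) (dget d.zeta c)

/-- **THE ROUGH-STEP TEST.** [cite: KapelaZgliczynski2009, §4 Lemma 4.1; WalawskaWilczak2016, §2.1] -/
def check : Bool := d.centre.check && d.checkKZ

/-! ### Unpacking -/

/-- What `checkKZ = true` says. [folklore] -/
theorem of_checkKZ (h : d.checkKZ = true) :
    0 < d.eta.toReal ∧ ∀ c < d.n, 0 ≤ (dget d.Zh c).toReal ∧ 0 < (dget d.zeta c).toReal ∧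
      (d.xplus c).toReal ≤ 1 ∧
      IntervalD.hiLe (d.kzLhs c (dget d.Zh) (d.cbD c)) (dget d.Zh c) = true ∧
      IntervalD.hiLe (d.kzLhs c (dget d.zeta) (Dyad.ofInt 0)) (dget d.zeta c) = true := by
  unfold checkKZ at h
  simp only [Bool.and_eq_true, List.all_eq_true, List.mem_range] at h
  obtain ⟨heta, hc⟩ := h
  refine ⟨by simpa using (Dyad.blt_iff _ _).1 heta, fun c hc' => ?_⟩
  obtain ⟨⟨⟨⟨h1, h2⟩, h3⟩, h4⟩, h5⟩ := hc c hc'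
  exact ⟨by simpa using (Dyad.ble_iff _ _).1 h1, by simpa using (Dyad.blt_iff _ _).1 h2,
    by simpa using (Dyad.ble_iff _ _).1 h3, h4, h5⟩

/-! ### Soundness -/

section Sound

variable {ι : Type*} [Fintype ι] [DecidableEq ι] {κ : Type*} [Fintype κ]

omit [DecidableEq ι] in
/-- The hull contains the centre box, with the margin: for `z ∈ boxSet S` and `|y − z| ≤ Ẑ`, `boxSet Hs` is a
neighbourhood of `y`. [folklore] -/
theorem hull_nhds (e : ι ≃ Fin d.n) (hS : ∀ c < d.n, wfsD (IntervalD.aget d.S c) = true)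
    (heta : 0 < d.eta.toReal)
    {z : ι → ℝ} (hz : z ∈ boxSet (boxOf e d.S)) {y : ι → ℝ} (hy : ∀ i, |y i - z i| ≤ (dget d.Zh (e i)).toReal) :
    boxSet (boxOf e d.Hs) ∈ 𝓝 y := by
  rw [boxSet, ← Set.pi_univ_Icc]
  refine set_pi_mem_nhds Set.finite_univ fun i _ => ?_
  have hzi := (mem_boxSet_iff.1 hz) i
  have hwf := hS (e i) (e i).isLt
  have hzi' : IntervalD.mem (z i) (IntervalD.aget d.S (e i)) := mem_of_mem_toNI (wfD_of_wfsD hwf) hzi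
  have hyi := abs_le.1 (hy i)
  have hlo : (IntervalD.aget d.Hs (e i)).lo.toReal < y i := by
    unfold Hs; rw [IntervalD.aget_ofFn _ (e i).isLt]
    simp only [Dyad.toReal_sub, Dyad.toReal_add]
    linarith [hzi'.1]
  have hhi : y i < (IntervalD.aget d.Hs (e i)).hi.toReal := by
    unfold Hs; rw [IntervalD.aget_ofFn _ (e i).isLt]
    simp only [Dyad.toReal_add]
    linarith [hzi'.2]
  have hwfH : (IntervalD.aget d.Hs (e i)).lo.toReal ≤ (IntervalD.aget d.Hs (e i)).hi.toReal := by linarith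
  simp only [boxLo_apply, boxHi_apply, boxOf, toNI, dif_pos hwfH]
  exact Icc_mem_nhds hlo hhi

omit [DecidableEq ι] in
/-- The centre box is contained in the hull. [folklore] -/
theorem boxSet_S_subset_Hs (e : ι ≃ Fin d.n) (hS : ∀ c < d.n, wfsD (IntervalD.aget d.S c) = true)
    (hZ : ∀ c < d.n, 0 ≤ (dget d.Zh c).toReal) (heta : 0 < d.eta.toReal) :
    boxSet (boxOf e d.S) ⊆ boxSet (boxOf e d.Hs) := fun z hz =>
  mem_of_mem_nhds (d.hull_nhds e hS heta hz (y := z) fun i => by simp [hZ (e i) (e i).isLt])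

omit [DecidableEq ι] in
/-- The hull is well-formed. [folklore] -/
theorem wf_Hs (hS : ∀ c < d.n, wfsD (IntervalD.aget d.S c) = true) (hZ : ∀ c < d.n, 0 ≤ (dget d.Zh c).toReal)
    (heta : 0 < d.eta.toReal) {c : ℕ} (hc : c < d.n) :
    (IntervalD.aget d.Hs c).lo.toReal ≤ (IntervalD.aget d.Hs c).hi.toReal := by
  have hwf := (Dyad.blt_iff _ _).1 (hS c hc)
  unfold Hs; rw [IntervalD.aget_ofFn _ hc]
  simp only [Dyad.toReal_sub, Dyad.toReal_add]
  linarith [hZ c hc]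

omit [Fintype ι] [DecidableEq ι] in
/-- Points of the hull read as `mem` facts. [folklore] -/
theorem mem_of_mem_Hs (e : ι ≃ Fin d.n) (hS : ∀ c < d.n, wfsD (IntervalD.aget d.S c) = true)
    (hZ : ∀ c < d.n, 0 ≤ (dget d.Zh c).toReal) (heta : 0 < d.eta.toReal)
    {x : ι → ℝ} (hx : x ∈ boxSet (boxOf e d.Hs)) (i : ι) :
    IntervalD.mem (x i) (IntervalD.aget d.Hs (e i)) := by
  have hxi := (mem_boxSet_iff.1 hx) i
  simp only [boxOf] at hxi
  rw [toNI, dif_pos (d.wf_Hs hS hZ heta (e i).isLt), NonemptyInterval.mem_def] at hxi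
  exact hxi

/-- **SOUNDNESS OF THE ROUGH-STEP TEST.** See the module docstring. [cite: KapelaZgliczynski2009, §4 Lemma 4.1; WalawskaWilczak2016, §2.1 and §2.2 Lemma 2; Moore1979, §8.1 eq. (8.13)] -/
theorem sound (e : ι ≃ Fin d.n) {Tc : κ → BTerm ι} {Tf : ℝ → κ → BTerm ι} {rows : ι → List κ}
    (hRDc : IsRTEncl e Tc Tc rows d.RD) (hRD : ∀ t ∈ Ico 0 d.hD.toReal, IsRTEncl e Tc (Tf t) rows d.RD)
    (hc : d.check = true) :
    ∃ uc : (ι → ℝ) → ℝ → ι → ℝ,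
      IsSolutionFamily (termField Tc) (boxSet (boxOf e d.S)) (boxSet (boxOf e d.W)) d.hD.toReal uc ∧
      (∀ z : ℝ → ι → ℝ, z 0 ∈ boxSet (boxOf e d.W) →
        (∀ t ∈ Icc 0 d.hD.toReal, HasDerivWithinAt z (termField Tc (z t)) (Icc 0 d.hD.toReal) t) →
        ∀ t ∈ Icc 0 d.hD.toReal, z t ∈ boxSet (boxOf e d.S)) ∧
      (∀ x ∈ boxSet (boxOf e d.W), ∀ τ ∈ Icc 0 d.hD.toReal, ∃ J : (ι → ℝ) →L[ℝ] (ι → ℝ),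
        HasFDerivWithinAt (fun x' => uc x' τ) J (boxSet (boxOf e d.W)) x ∧
        ∀ i l, (d.centre.vv (e i) (e l)).lo.toReal ≤ J (Pi.single l 1) i ∧
          J (Pi.single l 1) i ≤ (d.centre.vv (e i) (e l)).hi.toReal) ∧
      boxSet (boxOf e d.S) ⊆ boxSet (boxOf e d.Hs) ∧
      ∀ a ∈ boxSet (boxOf e d.W), ∀ Su : ℝ → ι → ℝ, Su 0 = a →
        (∀ t ∈ Icc 0 d.hD.toReal, HasDerivWithinAt Su (termField (Tf t) (Su t)) (Icc 0 d.hD.toReal) t) →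
        ∀ t ∈ Icc 0 d.hD.toReal, Su t ∈ boxSet (boxOf e d.Hs) ∧ ∀ i, |Su t i - uc a t i| ≤ (dget d.Zh (e i)).toReal := by
  classical
  have hc' : d.centre.check = true ∧ d.checkKZ = true := by simpa [check, Bool.and_eq_true] using hc
  obtain ⟨hcc, hkz⟩ := hc'
  obtain ⟨heta, hK⟩ := d.of_checkKZ hkz
  -- the centre step
  obtain ⟨uc, hu, hstay, hder⟩ := d.centre.sound Tc e (isSQEnclosure_sqC e hRDc d.prec) hcc
  have hcS := (d.centre.of_checkWith (by rw [← CentreStepD.check_eq]; exact hcc)).2.2.1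
  have hh : 0 ≤ d.hD.toReal := (d.centre.of_checkWith (by rw [← CentreStepD.check_eq]; exact hcc)).2.1
  have hwfS : ∀ c < d.n, wfsD (IntervalD.aget d.S c) = true := fun c hc => (hcS c hc).2.1
  have hZ : ∀ c < d.n, 0 ≤ (dget d.Zh c).toReal := fun c hc => (hK c hc).1
  have hSH := d.boxSet_S_subset_Hs e hwfS hZ heta
  refine ⟨uc, hu, hstay, hder, hSH, fun a ha Su hSu0 hSu t ht => ?_⟩
  -- the K–Z data on the hull
  set Hr := boxOf e d.Hs with hHr
  set dg : ι → ℝ := fun i => (d.dgD (e i)).toReal with hdg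
  set R : ι → ι → ℝ := fun i j => (d.RD' (e i) (e j)).toReal with hRdef
  set cb : ι → ℝ := fun i => (d.cbD (e i)).toReal with hcb
  set Zb : ι → ℝ := fun i => (dget d.Zh (e i)).toReal with hZb
  set E : ι → ℝ := fun i => (d.ED (e i)).toReal with hE
  set ζ : ι → ℝ := fun i => (dget d.zeta (e i)).toReal with hζ
  have hmemH : ∀ x ∈ boxSet Hr, ∀ i, IntervalD.mem (x i) (IntervalD.aget d.Hs (e i)) := fun x hx i =>
    d.mem_of_mem_Hs e hwfS hZ heta hx i
  -- Jacobian bounds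
  have hjac : ∀ x ∈ boxSet Hr, ∀ i j, IntervalD.mem (jacEntry Tc x i j) (d.jac (e i) (e j)) := fun x hx i j =>
    mem_jacEntry_jacRow e hRDc d.prec (hmemH x hx) i j
  have hdgb : ∀ x ∈ boxSet Hr, ∀ i, (termFieldDeriv Tc x) (Pi.single i 1) i ≤ dg i := fun x hx i => by
    rw [termFieldDeriv_single]; exact (hjac x hx i i).2
  have hR0 : ∀ i j, 0 ≤ R i j := fun i j => by
    simp only [hRdef, RD']
    split_ifs
    · simp
    · exact mag_toReal_nonneg _
  have hRb : ∀ x ∈ boxSet Hr, ∀ i j, i ≠ j → |(termFieldDeriv Tc x) (Pi.single j 1) i| ≤ R i j := by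
    intro x hx i j hij
    rw [termFieldDeriv_single]
    simp only [hRdef, RD', if_neg (fun h => hij (e.injective (Fin.ext h)))]
    exact IntervalD.abs_le_mag (hjac x hx i j)
  have hcb0 : ∀ i, 0 ≤ cb i := fun i => mag_toReal_nonneg _
  have hδ : ∀ t ∈ Ico 0 d.hD.toReal, ∀ x ∈ boxSet Hr, ∀ i, |termField (Tf t) x i - termField Tc x i| ≤ cb i :=
    fun t ht x hx i => abs_termField_sub_le_cbRow e (hRD t ht) d.prec (hmemH x hx) i
  have hZb0 : ∀ i, 0 ≤ Zb i := fun i => hZ (e i) (e i).isLt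
  have hEb : ∀ i, gronwallBound 0 (dg i) 1 d.hD.toReal ≤ E i := by
    intro i
    have hx := (hK (e i) (e i).isLt).2.2.1
    simp only [xplus, Dyad.toReal_max, Dyad.toReal_mul, Dyad.toReal_ofInt, Int.cast_zero, max_le_iff] at hx
    refine (gronwallBound_le_lin hh hx.1).trans (le_of_eq ?_)
    simp only [hE, ED, xplus, Dyad.toReal_mul, Dyad.toReal_add, Dyad.toReal_max, Dyad.toReal_ofInt]
    push_cast; ring
  -- the two K–Z inequalities from the interval checks
  have hkz : ∀ i (v : ℕ → Dyad) (w : Dyad),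
      IntervalD.mem (((∑ j, R i j * (v (e j)).toReal) + w.toReal) * E i) (d.kzLhs (e i) v w) := by
    intro i v w
    unfold kzLhs
    refine IntervalD.mem_mulR d.prec (IntervalD.mem_addR d.prec ?_ (IntervalD.mem_ofDyad w)) (IntervalD.mem_ofDyad _)
    refine mem_sum_equiv e d.prec fun k hk => ?_
    simp only [hRdef, Equiv.apply_symm_apply]
    exact IntervalD.mem_mulR d.prec (IntervalD.mem_ofDyad _) (IntervalD.mem_ofDyad _)
  have hfix : ∀ i, ((∑ j, R i j * Zb j) + cb i) * E i ≤ Zb i := fun i =>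
    IntervalD.le_of_hiLe (hK (e i) (e i).isLt).2.2.2.1 (hkz i (dget d.Zh) (d.cbD (e i)))
  have hζ0 : ∀ i, 0 < ζ i := fun i => (hK (e i) (e i).isLt).2.1
  have hdir : ∀ i, (∑ j, R i j * ζ j) * E i ≤ ζ i := fun i => by
    have h := IntervalD.le_of_hiLe (hK (e i) (e i).isLt).2.2.2.2 (hkz i (dget d.zeta) (Dyad.ofInt 0))
    simpa using h
  -- the bootstrap
  have hres := stepDeviation_bootstrap hh (convex_boxSet Hr) (isClosed_Icc)
    (f := fun t x => termField (Tf t) x) (fc := termField Tc) (fc' := termFieldDeriv Tc) (S := Su) (C := uc a)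
    hSu (hu.hasDerivWithinAt a ha) (by rw [hSu0, hu.init a ha]) (fun t ht => hSH (hu.mem a ha t ht))
    (dg := dg) (cb := cb) (Zb := Zb) (E := E) (ζ := ζ) (R := R)
    (fun t ht y hy => d.hull_nhds e hwfS heta (hu.mem a ha t ht) hy)
    (fun x _ => hasFDerivWithinAt_termField Tc _ x) hdgb hR0 hRb hcb0 hδ hZb0 hEb hfix hζ0 hdir t ht
  exact hres

end Sound

end RoughStepD

end DSSOneShift

end Summit.NavierStokesRegularity.NavierStokesRegularity.Theorems
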